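import Literature.Probability.RandomPlanarGeometry.HexSAWRotSlabSummable
import Literature.Probability.RandomPlanarGeometry.HexSAWRotStripLateralNullY
import HarnessLib

/-!
# Beaton 2014 Corollary 13 at general `y`, unconditional at strip level: `E^→_{H,W}(x_c; y) → 0` whenever
# `W ↦ B^→_{H,W}(x_c; y)` is bounded

Topic `Literature/Probability/RandomPlanarGeometry` (the leaf joining `HexSAWRotStripLateralNullY.lean` — a-p6 g7/g8's
`HV.rotELimZeroY_of_slabSummable`, CONDITIONAL on the y-free face `HV.RotSlabWalksSummable (H − 1)` — with `HexSAWRotSlabSummable.lean` —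
`HV.rotSlabWalks_summable H₀`, that face for every `H₀`, from the door R100 «HEX-ARMCHAIR-SLAB-SUBCRIT» `HexBW.summable_slabCount_mul_pow`).
Source: N. R. Beaton, *J. Phys. A* 47 (2014), arXiv:1210.0274v3, §4, Corollary 13 (p. 17: «for 0 ≤ y < y†, … E_T(x_c, y) = 0», there via
«Ĉ_T(x_c,y) is convergent for 0 ≤ y < y†» = Corollary 10) with the proof of Proposition 11 (p. 18); here typed AT THE SAME `y` under boundedness of
the top class (which holds for `y < y†` by `HV.rotGFy_top_tendsto`), the slab input at `y = 1` only.

* **`HV.rotELimZeroY_holds`** — for `H ≥ 1`, `y ≥ 0`: if `∀ W, B^→_{H,W}(x_c; y) ≤ K` then `E^→_{H,W}(x_c; y) → 0` as `W → ∞`.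
-/

noncomputable section

open Filter Topology

namespace Literature.Probability.RandomPlanarGeometry.SAW.HV

/-- **Beaton 2014 Corollary 13 at general `y` (strip level, unconditional)**: for `H ≥ 1` and `y ≥ 0`, if the right-started top
class of `D(H, W) ∖ {a⁻}` is bounded in `W` then the lateral class tends to `0`.
[cite: Beaton2014RotatedHoneycomb, §4, Corollary 13 (arXiv:1210.0274v3 p. 17) with the proof of Proposition 11 (p. 18) — slab input: Corollary 10 at y = 1, here `HexBW.summable_slabCount_mul_pow`] -/
theorem rotELimZeroY_holds {H : ℕ} (hH : 1 ≤ H) {y K : ℝ} (hy : 0 ≤ y)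
    (hK : ∀ Wd : ℕ, rotGFy ((rotStripV H Wd).erase wOut) H (IsRotTopDart H) y ≤ K) :
    Tendsto (fun Wd : ℕ => rotGFy ((rotStripV H Wd).erase wOut) H (IsRotLatDart H Wd) y) atTop (𝓝 0) :=
  rotELimZeroY_of_slabSummable hH (rotSlabWalks_summable (H - 1)) hy hK

end Literature.Probability.RandomPlanarGeometry.SAW.HV
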